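import Summits.ValiantsHypothesis.ValiantsHypothesis.Theorems.KPlusLogSqLawTropicalBLongRangeAtoms

/-!
# Route «KPlusLogSqLaw», crux `TropicalB` (stmt-ValiantsHypothesis-19771) — LONG-RANGE ATOMS, part 2: LINKED ATOMS
# (off arithmetic progressions, two consecutive steps of a counting-tight chain share a changed column)

HONEST FRAMING.  Sequel of `…TropicalBLongRangeAtoms` (seat val-sym-trop-p1 g21, cell `pub-symmetroid`, 2026-08-28; `--supports
stmt-ValiantsHypothesis-19771 --as helper`).  A STRUCTURE law valid for every dominance design at every format (no hypothesis on exponents,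
valuations, support or signs); nothing here bounds `TropicalB` in its window or bears on `WeakLifting`, DoorA26 / DoorA34, `MatrixDescartes`
(stmt-ValiantsHypothesis-18050) or VP ≠ VNP.

THE LAW.  Let `p₀ ≺ … ≺ pₙ` be dominant terms at strictly increasing integer slopes with distinct consecutive terms, EXHAUSTING THE SLOPE BUDGET
(`#slopeSet m d ≤ n + 1`; e.g. counting-tight, `multichoose K m ≤ n + 1`).  By part 1 (`two_apart_ap`) a composite pair two apart forces the three
slopes into arithmetic progression.  Here:
* `changeSet_invariant` — the change set of a pair of terms (columns differing in row or class) is invariant under their quotient permutation;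
* `split_of_disjoint_changes` — if the change sets of `(p₀, p₁)` and `(p₁, p₂)` are DISJOINT (and both steps genuine), the change set of the first
  step is an invariant block of `σ₀⁻¹σ₂` separating the changes of `(p₀, p₂)`: the pair two apart is composite;
* **`linked_atoms`** — hence, wherever three consecutive slopes are NOT in arithmetic progression, the two consecutive steps
  `p_k → p_{k+1} → p_{k+2}` SHARE a changed column; census form `linked_atoms_of_multichoose_le` (signed hypotheses of `TropRow`).
LOCATED CHECK (seat folder py/linked.py): on the kernel's counting-tight `(5,4)` chain (…TropicalCensusFiveFourTight, d = (0,7,22,34)) 43 of the 54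
positions are off arithmetic progressions and at all of them the consecutive atoms are linked; at the AP positions `k = 30, 45` the consecutive
atoms ARE disjoint — the exception in the law is real.  Reading for the construction side (fork lane D2, `ktight`-type searches for full chains): off
APs the successor step must touch the previous step's orbit.  [exchange argument + pigeonhole; the packaging is this cell's, no citation exists]
-/

set_option linter.dupNamespace false
set_option autoImplicit false

namespace Summit.ValiantsHypothesis.ValiantsHypothesis.Theorems.KPlusLogSqLaw.LongRangeAtom

open Summit.ValiantsHypothesis.ValiantsHypothesis.Theorems.MatrixDescartes.Negative
open Summit.ValiantsHypothesis.ValiantsHypothesis.Theorems.LacunarySymmetroidMatrixDescartes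
open Summit.ValiantsHypothesis.ValiantsHypothesis.Theorems.LacunarySymmetroidMatrixDescartes.TropicalCensus
open Summit.ValiantsHypothesis.ValiantsHypothesis.Theorems.KPlusLogSqLaw.Sumset
open Summit.ValiantsHypothesis.ValiantsHypothesis.Theorems.KPlusLogSqLaw.AtomBudget
open scoped BigOperators
open Finset

variable {m K : ℕ}

/-! ## 1. Change sets and the composite pair made by two disjoint steps -/

/-- membership in the CHANGE SET of an ordered pair of terms (the columns where they differ in row or in class). [bookkeeping] -/
theorem mem_changeSet_iff (p q : Equiv.Perm (Fin m) × (Fin m → Fin K)) (b : Fin m) :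
    b ∈ (univ.filter fun b => p.1 b ≠ q.1 b ∨ p.2 b ≠ q.2 b) ↔ (p.1 b ≠ q.1 b ∨ p.2 b ≠ q.2 b) := by
  simp only [Finset.mem_filter, Finset.mem_univ, true_and]

/-- the change set of `(p, q)` is invariant under the quotient `σ_p⁻¹ σ_q` (moved columns map to moved columns, fixed columns to
themselves). [folklore] -/
theorem changeSet_invariant (p q : Equiv.Perm (Fin m) × (Fin m → Fin K)) (b : Fin m) :
    (p.1⁻¹ * q.1) b ∈ (univ.filter fun b => p.1 b ≠ q.1 b ∨ p.2 b ≠ q.2 b) ↔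
      b ∈ (univ.filter fun b => p.1 b ≠ q.1 b ∨ p.2 b ≠ q.2 b) := by
  rw [mem_changeSet_iff, mem_changeSet_iff]
  by_cases hb : p.1 b = q.1 b
  · -- `b` is a fixed column of the quotient
    have hfix : (p.1⁻¹ * q.1) b = b := by
      rw [Equiv.Perm.mul_apply, Equiv.Perm.inv_eq_iff_eq]; exact hb.symm
    rw [hfix]
  · -- `b` is moved, and so is its image
    constructor
    · intro _; exact Or.inl hb
    · intro _
      left
      intro h
      apply hb
      have hpq : p.1 (p.1⁻¹ (q.1 b)) = q.1 b := by simp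
      rw [Equiv.Perm.mul_apply, hpq] at h
      have hb' : b = p.1⁻¹ (q.1 b) := q.1.injective h
      exact Equiv.Perm.eq_inv_iff_eq.mp hb'

/-- **DISJOINT CONSECUTIVE ATOMS MAKE A COMPOSITE PAIR.**  For three terms `p₀, p₁, p₂`: if the change sets of `(p₀, p₁)` and of `(p₁, p₂)`
are disjoint, then the change set `T` of `(p₀, p₁)` is invariant under `σ₀⁻¹σ₂`, and — when both steps are genuine (`p₀ ≠ p₁`, `p₁ ≠ p₂`) — the
pair `(p₀, p₂)` differs somewhere on `T` and somewhere off `T`. [folklore bookkeeping] -/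
theorem split_of_disjoint_changes (p₀ p₁ p₂ : Equiv.Perm (Fin m) × (Fin m → Fin K))
    (hdisj : ∀ b, (p₀.1 b ≠ p₁.1 b ∨ p₀.2 b ≠ p₁.2 b) → ¬ (p₁.1 b ≠ p₂.1 b ∨ p₁.2 b ≠ p₂.2 b))
    (h01 : p₀ ≠ p₁) (h12 : p₁ ≠ p₂) :
    (∀ b, (p₀.1⁻¹ * p₂.1) b ∈ (univ.filter fun b => p₀.1 b ≠ p₁.1 b ∨ p₀.2 b ≠ p₁.2 b) ↔
        b ∈ (univ.filter fun b => p₀.1 b ≠ p₁.1 b ∨ p₀.2 b ≠ p₁.2 b)) ∧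
    (∃ b ∈ (univ.filter fun b => p₀.1 b ≠ p₁.1 b ∨ p₀.2 b ≠ p₁.2 b), p₀.1 b ≠ p₂.1 b ∨ p₀.2 b ≠ p₂.2 b) ∧
    (∃ b ∉ (univ.filter fun b => p₀.1 b ≠ p₁.1 b ∨ p₀.2 b ≠ p₁.2 b), p₀.1 b ≠ p₂.1 b ∨ p₀.2 b ≠ p₂.2 b) := by
  classical
  have hsame12 : ∀ b, ¬ (p₁.1 b ≠ p₂.1 b ∨ p₁.2 b ≠ p₂.2 b) → p₁.1 b = p₂.1 b ∧ p₁.2 b = p₂.2 b := by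
    intro b h; push Not at h; exact h
  have hsame01 : ∀ b, ¬ (p₀.1 b ≠ p₁.1 b ∨ p₀.2 b ≠ p₁.2 b) → p₀.1 b = p₁.1 b ∧ p₀.2 b = p₁.2 b := by
    intro b h; push Not at h; exact h
  refine ⟨fun b => ?_, ?_, ?_⟩
  · rw [mem_changeSet_iff, mem_changeSet_iff]
    by_cases hb : p₀.1 b ≠ p₁.1 b ∨ p₀.2 b ≠ p₁.2 b
    · -- `b` changed at the first step, hence not at the second: `σ₂ b = σ₁ b`
      obtain ⟨hr, -⟩ := hsame12 b (hdisj b hb)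
      have heq : (p₀.1⁻¹ * p₂.1) b = (p₀.1⁻¹ * p₁.1) b := by
        rw [Equiv.Perm.mul_apply, Equiv.Perm.mul_apply, hr]
      rw [heq]
      have hinv := changeSet_invariant p₀ p₁ b
      rw [mem_changeSet_iff, mem_changeSet_iff] at hinv
      exact ⟨fun _ => hb, fun _ => hinv.mpr hb⟩
    · -- `b` unchanged at the first step
      obtain ⟨hr01, _⟩ := hsame01 b hb
      refine ⟨fun h => ?_, fun h => absurd h hb⟩
      by_cases hb2 : p₁.1 b ≠ p₂.1 b ∨ p₁.2 b ≠ p₂.2 b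
      · -- `c := (σ₁⁻¹σ₂) b` lies in the second change set (invariance), hence not in the first
        set c := (p₁.1⁻¹ * p₂.1) b with hc
        have hc2 : p₁.1 c ≠ p₂.1 c ∨ p₁.2 c ≠ p₂.2 c := by
          have := changeSet_invariant p₁ p₂ b
          rw [mem_changeSet_iff, mem_changeSet_iff] at this
          exact this.mpr hb2
        have hc1 : ¬ (p₀.1 c ≠ p₁.1 c ∨ p₀.2 c ≠ p₁.2 c) := fun h1 => hdisj c h1 hc2
        obtain ⟨hr0c, -⟩ := hsame01 c hc1
        have h1c : p₁.1 c = p₂.1 b := by simp [hc, Equiv.Perm.mul_apply]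
        have himg : (p₀.1⁻¹ * p₂.1) b = c := by
          rw [Equiv.Perm.mul_apply, Equiv.Perm.inv_eq_iff_eq, hr0c, h1c]
        rw [himg] at h
        exact absurd h hc1
      · obtain ⟨hr12, -⟩ := hsame12 b hb2
        have hfix : (p₀.1⁻¹ * p₂.1) b = b := by
          rw [Equiv.Perm.mul_apply, Equiv.Perm.inv_eq_iff_eq, ← hr12, hr01]
        rw [hfix] at h
        exact absurd h hb
  · have : ∃ b, p₀.1 b ≠ p₁.1 b ∨ p₀.2 b ≠ p₁.2 b := by
      by_contra hc
      push Not at hc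
      exact h01 (Prod.ext (Equiv.ext fun b => (hc b).1) (funext fun b => (hc b).2))
    obtain ⟨b, hb⟩ := this
    obtain ⟨hr, hcl⟩ := hsame12 b (hdisj b hb)
    refine ⟨b, (mem_changeSet_iff p₀ p₁ b).mpr hb, ?_⟩
    rcases hb with h | h
    · exact Or.inl (by rw [← hr]; exact h)
    · exact Or.inr (by rw [← hcl]; exact h)
  · have : ∃ b, p₁.1 b ≠ p₂.1 b ∨ p₁.2 b ≠ p₂.2 b := by
      by_contra hc
      push Not at hc
      exact h12 (Prod.ext (Equiv.ext fun b => (hc b).1) (funext fun b => (hc b).2))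
    obtain ⟨b, hb⟩ := this
    have hb1 : ¬ (p₀.1 b ≠ p₁.1 b ∨ p₀.2 b ≠ p₁.2 b) := fun h1 => hdisj b h1 hb
    obtain ⟨hr, hcl⟩ := hsame01 b hb1
    refine ⟨b, fun hmem => hb1 ((mem_changeSet_iff p₀ p₁ b).mp hmem), ?_⟩
    rcases hb with h | h
    · exact Or.inl (by rw [hr]; exact h)
    · exact Or.inr (by rw [hcl]; exact h)

section Chain

variable (d : Fin K → ℕ) (v ε : Fin m → Fin m → Fin K → ℤ) {n : ℕ}
  (θ : Fin (n + 1) → ℤ) (p : Fin (n + 1) → Equiv.Perm (Fin m) × (Fin m → Fin K))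

/-- **LINKED ATOMS.**  In a chain exhausting the slope budget, if three consecutive slopes are NOT in arithmetic progression then the two
consecutive steps `p_k → p_{k+1} → p_{k+2}` share a changed column: some column changes (in row or class) at BOTH steps.  (Off arithmetic
progressions consecutive atoms are linked; at arithmetic progressions they may be disjoint — both happen on the kernel's tight `(5,4)` chain.)
[this cell] -/
theorem linked_atoms (hθ : StrictMono θ) (hdom : ∀ k, IsDominant d v ε (θ k) (p k))
    (hne : ∀ k : Fin n, p k.castSucc ≠ p k.succ) (htight : (slopeSet m d).card ≤ n + 1)
    {k₀ k₁ k₂ : Fin (n + 1)} (h₁ : (k₁ : ℕ) = k₀ + 1) (h₂ : (k₂ : ℕ) = k₀ + 2)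
    (hnap : TropicalCensus.slope d (p k₀) + TropicalCensus.slope d (p k₂) ≠ 2 * TropicalCensus.slope d (p k₁)) :
    ∃ b : Fin m, ((p k₀).1 b ≠ (p k₁).1 b ∨ (p k₀).2 b ≠ (p k₁).2 b) ∧ ((p k₁).1 b ≠ (p k₂).1 b ∨ (p k₁).2 b ≠ (p k₂).2 b) := by
  classical
  by_contra hcon
  push Not at hcon
  have hdisj : ∀ b, ((p k₀).1 b ≠ (p k₁).1 b ∨ (p k₀).2 b ≠ (p k₁).2 b) →
      ¬ ((p k₁).1 b ≠ (p k₂).1 b ∨ (p k₁).2 b ≠ (p k₂).2 b) := by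
    intro b hb h2
    have := hcon b hb
    rcases h2 with h | h
    · exact h this.1
    · exact h this.2
  have hk₀ : (k₀ : ℕ) < n := by have := k₂.isLt; omega
  have hk₁ : (k₁ : ℕ) < n := by have := k₂.isLt; omega
  have e0 : k₀ = (⟨k₀, hk₀⟩ : Fin n).castSucc := Fin.ext rfl
  have e1 : k₁ = (⟨k₀, hk₀⟩ : Fin n).succ := Fin.ext (show (k₁ : ℕ) = (k₀ : ℕ) + 1 by omega)
  have e1' : k₁ = (⟨k₁, hk₁⟩ : Fin n).castSucc := Fin.ext rfl
  have e2 : k₂ = (⟨k₁, hk₁⟩ : Fin n).succ := Fin.ext (show (k₂ : ℕ) = (k₁ : ℕ) + 1 by omega)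
  have h01 : p k₀ ≠ p k₁ := by rw [e0, e1]; exact hne _
  have h12 : p k₁ ≠ p k₂ := by rw [e1', e2]; exact hne _
  obtain ⟨hT, hin, hout⟩ := split_of_disjoint_changes (p k₀) (p k₁) (p k₂) hdisj h01 h12
  exact hnap (two_apart_ap d v ε θ p hθ hdom hne htight h₁ h₂ _ hT hin hout)

/-- **linked atoms, census form** (counting-tight sign-alternating chains). [this cell] -/
theorem linked_atoms_of_multichoose_le (hθ : StrictMono θ) (hdom : ∀ k, IsDominant d v ε (θ k) (p k))
    (halt : ∀ k : Fin n, termSign ε (p k.castSucc) * termSign ε (p k.succ) < 0) (htight : Nat.multichoose K m ≤ n + 1)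
    {k₀ k₁ k₂ : Fin (n + 1)} (h₁ : (k₁ : ℕ) = k₀ + 1) (h₂ : (k₂ : ℕ) = k₀ + 2)
    (hnap : TropicalCensus.slope d (p k₀) + TropicalCensus.slope d (p k₂) ≠ 2 * TropicalCensus.slope d (p k₁)) :
    ∃ b : Fin m, ((p k₀).1 b ≠ (p k₁).1 b ∨ (p k₀).2 b ≠ (p k₁).2 b) ∧ ((p k₁).1 b ≠ (p k₂).1 b ∨ (p k₁).2 b ≠ (p k₂).2 b) :=
  linked_atoms d v ε θ p hθ hdom (ne_succ_of_alternating ε p halt) ((card_slopeSet_le_multichoose d).trans htight) h₁ h₂ hnap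

end Chain

end Summit.ValiantsHypothesis.ValiantsHypothesis.Theorems.KPlusLogSqLaw.LongRangeAtom
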